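import Summits.KontsevichZagierPeriods.Zeta5Search.TwoTaleP15Endgame

/-!
# P15: the `p`-coincidence from two decays and one common prime class

HONEST FRAMING: systematic search; no irrationality claim unless certified.  NOTHING about `ζ(2)`
is certified here beyond the tree's facts: every measure statement below is an IMPLICATION whose
second-tale inputs `DecayT` and `IntegralT` are NOT tree theorems (and `IntegralT` is not in
print either — see its docstring).

Cell pub-zeta5, fam-denom g7 (design `families/denom/P15KERNEL.md` §10).  The tree's P15 endgame
`TwoTaleP15.zetaTwo_exponent_le_of_pCoincidence` is conditional on the `p`-half of Zudilin's
two-tale coincidence (bmiss)@P15, `p_n = −p̂_n` for ALL `n ≥ 1` — an IDENTITY which in print is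
a case of the Barnes-integral identity (bmiss), "expected to be true" and NOT proved in
[Zudilin2014ZetaTwo] (its `q`-half is Whipple's transformation, a tree theorem).  This file PROVES a
reduction of that identity (for all large `n`, which is all the measure needs) to two inputs of a
different kind:

* `DecayT c'` — DECAY of the second tale, `|q̂_n ζ(2) − p̂_n| ≤ e^{−c'n}` eventually, needed only
  with `c' > 31 − ∫_{[1/11,2/17)} dψ = 28.46188…` (model value of the rate: the same
  `C₀ = 29.10787127` as the first tale, vertical-line saddle of the partner's Barnes integrand;
  design numerics `code/denom/p15/t2refine.py`; certifiable by the cell's line machine, cf.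
  `Denom.TwoTaleP15DecayHolds.decay_holds_sharp : Decay 29.10787` for the first tale);
* `IntegralT` — a DENOMINATOR statement, `D₁₆ₙD₁₅ₙ p̂_n ∈ ℤ` eventually.  OPEN: it follows from
  (bmiss)@P15 (then `p̂_n = −p_n` and [Zudilin2014ZetaTwo, Prop. 1]), but in print only
  `D₂₂ₙD₂₆ₙ p̂_n ∈ ℤ` is available ([Zudilin2014ZetaTwo, Prop. 3] at the partner parameters:
  `ĉ₁ = 22n`, `ĉ₂ = 26n`), whose rate `48` is far too large for the argument below.  An exact
  probe (`code/denom/p15/phat.py`, `n ≤ 4`) locates its content in tail congruences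
  `2 Σ_{k ≥ k_p} A_k + p Σ_{k ≥ k_p} B_k ≡ 0 (mod p²)` for the primes `17n < p ≤ 26n`
  (`P15KERNEL.md` §10.5).

**Mechanism (PROVED here).**  Whipple's coincidence `q_n = −q̂_n` IS a tree theorem
(`TwoTaleWhipple.whippleP15_holds`), so `r_n + r̂_n = −(p_n + p̂_n)` and
`|p_n + p̂_n| ≤ e^{−cn} + e^{−c'n}` with the first tale's PROVED `c = 29.10787`.  For every prime
of the class `ivl 9 = [1/11, 2/17)` (`26n < p²`) the tree proves, WITHOUT any coincidence, both
`p ∣ D₁₆ₙD₁₅ₙ p_n` (first tale, `TwoTaleP15.ivl_1_left`) and `ord_p p̂_n ≥ 0` (second tale,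
`TwoTaleP15.phat_ivl_9_EZ` with `padicNorm_formPT_le`).  Hence the integer
`D₁₆ₙD₁₅ₙ (p_n + p̂_n)` is divisible by `P_n = ivlProduct 9 n = e^{(2.53811… + o(1)) n}` while
its absolute value is `≤ e^{(31 + o(1)) n} · 2e^{−min(c,c') n} < P_n`; so it vanishes
(`pCoincidence_eventually`).  An EVENTUAL coincidence feeds the measure through the tree's
`exponentLE_of_normalisedForms` with the forms zeroed below the threshold
(`exponentLE_of_eventual_inclusion`, `zetaTwo_exponent_le_of_eventual_pCoincidence`), giving
`zetaTwo_exponent_le_of_decayT : DecayT c' → 31 − ivlRate 9 < c' → IntegralT →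
 ExponentLE (zetaValue 2) 5.0499 ∧ zetaTwo_irrationalityExponent_le`.
The value `5.0499` WOULD be below the printed record `5.09541178` [Zudilin2014ZetaTwo, Thm 1];
it is NOT claimed: `DecayT` and `IntegralT` are open inputs.

References: W. Zudilin, *Two hypergeometric tales and a new irrationality measure of ζ(2)*,
Ann. Math. Québec 38 (2014) 101–117, arXiv:1310.1526 [Zudilin2014ZetaTwo]; G. Rhin, C. Viola,
Acta Arith. 77 (1996) 23–56 [RhinViola1996] (prime classes `{n/p} ∈ [u,v)`).
-/

noncomputable section

open Filter Topology Finset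
open Literature.NumberTheory.Irrationality.Zudilin2014
open Literature.NumberTheory.Transcendental (zetaValue OddZeta.dvd_lcmUpto)
open Literature.NumberTheory.DiophantineApproximation.RhinViola (classPrimes)
open Summit.KontsevichZagierPeriods.Zeta5Search.TwoTaleP15
open Summit.KontsevichZagierPeriods.Zeta5Search.Denom.TwoTaleP15Saving
open Summit.KontsevichZagierPeriods.Zeta5Search.Denom.TwoTaleP15Forms (lcmNormaliser
  lcmNormaliser_pos Decay CoeffRate exponentLE_of_normalisedForms irrational_zetaValue_two
  tendsto_log_lcmNormaliser_div_savingProduct)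

namespace Summit.KontsevichZagierPeriods.Zeta5Search.Denom.TwoTaleP15Coincidence

/-! ### The two second-tale inputs (NOT certified) -/

/-- **INPUT T2 — decay of the second tale** with constant `c`: `|q̂_n ζ(2) − p̂_n| ≤ e^{−cn}` for
all large `n`, for Zudilin's second-tale form at the Remark-5 partner of P15
(`formQT`/`formPT` at `aT n`, `bT n`).  Model rate `29.10787127…` (`P15KERNEL.md` §10.2); NOT
certified. -/
@[conjecture] def DecayT (c : ℝ) : Prop :=
  ∀ᶠ n : ℕ in atTop,
    |(formQT (aT n) (bT n) : ℝ) * zetaValue 2 - (formPT (aT n) (bT n) : ℝ)| ≤ Real.exp (-(c * n))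

/-- **INPUT U3 — normalised integrality of the second tale**: `D₁₆ₙD₁₅ₙ p̂_n ∈ ℤ` for all large
`n`.  OPEN and NOT in print: implied by (bmiss)@P15; [Zudilin2014ZetaTwo, Prop. 3] gives only
`D₂₂ₙD₂₆ₙ p̂_n ∈ ℤ` at these parameters.  Exact for `n ≤ 4` (`code/denom/p15/phat.py`). -/
@[conjecture] def IntegralT : Prop :=
  ∀ᶠ n : ℕ in atTop, ∃ z : ℤ, ((lcmNormaliser n : ℕ) : ℚ) * formPT (aT n) (bT n) = z

/-! ### Rates -/

/-- Certified enclosure `2.5381141 ≤ ∫_{[1/11,2/17)} dψ ≤ 2.5381178` (`ψ(2/17) − ψ(1/11) =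
2.53811522…`; `K = 10` partial sum, the numbers of `savingRate_bounds`). -/
theorem ivlRate_nine_bounds : (2.5381141 : ℝ) ≤ ivlRate 9 ∧ ivlRate 9 ≤ 2.5381178 :=
  ivlRate_mem (i := 9) (K := 10) (by norm_num)
    (by norm_num [ivl, ivlTerm, sum_range_succ, sum_range_zero])
    (by norm_num [ivl, ivlTerm, sum_range_succ, sum_range_zero])

/-- `(1/n) log (D₁₆ₙD₁₅ₙ) → 31` (from the tree's two rates `31 − S` and `S`). -/
theorem tendsto_log_lcmNormaliser :
    Tendsto (fun n : ℕ => Real.log (lcmNormaliser n : ℝ) / n) atTop (𝓝 31) := by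
  have h := tendsto_log_lcmNormaliser_div_savingProduct.add tendsto_log_savingProduct_div
  have e : (31 : ℝ) - savingRate + savingRate = 31 := by ring
  rw [e] at h
  refine h.congr fun n => ?_
  have hD : (0 : ℝ) < (lcmNormaliser n : ℝ) := by exact_mod_cast lcmNormaliser_pos n
  have hΦ : (0 : ℝ) < (savingProduct n : ℝ) := by exact_mod_cast savingProduct_pos n
  rw [Real.log_div hD.ne' hΦ.ne']
  ring

/-- Eventually `e^{(ivlRate 9 − ε) n} ≤ P_n = ivlProduct 9 n`. -/
theorem eventually_exp_le_ivlProduct {ε : ℝ} (hε : 0 < ε) :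
    ∀ᶠ n : ℕ in atTop, Real.exp ((ivlRate 9 - ε) * n) ≤ (ivlProduct 9 n : ℝ) :=
  eventually_exp_mul_le_of_tendsto_log_div (f := fun n : ℕ => (ivlProduct 9 n : ℝ))
    (fun n => by exact_mod_cast ivlProduct_pos 9 n) (tendsto_log_ivlProduct_div 9) (by linarith)

/-- Eventually `D₁₆ₙD₁₅ₙ ≤ e^{(31 + ε) n}`. -/
theorem eventually_lcmNormaliser_le_exp {ε : ℝ} (hε : 0 < ε) :
    ∀ᶠ n : ℕ in atTop, (lcmNormaliser n : ℝ) ≤ Real.exp ((31 + ε) * n) :=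
  eventually_le_exp_mul_of_tendsto_log_div (f := fun n : ℕ => (lcmNormaliser n : ℝ))
    (fun n => by exact_mod_cast lcmNormaliser_pos n) tendsto_log_lcmNormaliser (by linarith)

/-! ### The common prime class `ivl 9 = [1/11, 2/17)`: divisibility on both tales -/

/-- **Second tale at a class prime, no coincidence used:** for a prime `p` with `26n < p²` and
`{n/p} ∈ [1/11, 2/17)`, `p² ∣ D₁₆ₙD₁₅ₙ p̂_n` whenever the latter is an integer `z`
(`phat_ivl_9_EZ`: `E ≥ 2` on the whole `k`-range; `padicNorm_formPT_le`; `|D_m|_p ≤ p⁻¹` for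
`p ≤ m`, here `p ≤ 11n`). -/
theorem sq_dvd_of_integral {n p : ℕ} (hn : 1 ≤ n) (hp : p.Prime) (hp2 : 26 * n < p ^ 2)
    (h1 : (1 / 11 : ℝ) ≤ Int.fract ((n : ℝ) / p)) (h2 : Int.fract ((n : ℝ) / p) < 2 / 17) {z : ℤ}
    (hz : ((lcmNormaliser n : ℕ) : ℚ) * formPT (aT n) (bT n) = z) : (p : ℤ) ^ 2 ∣ z := by
  haveI : Fact p.Prime := ⟨hp⟩
  obtain ⟨hu, hv⟩ := mod_bounds_of_fract (U₁ := 1) (U₂ := 11) (V₁ := 2) (V₂ := 17) hp.pos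
    (by norm_num) (by norm_num) (by exact_mod_cast h1) (by exact_mod_cast h2)
  have hmod : n % p ≤ n := Nat.mod_le n p
  have hp15 : p ≤ 15 * n := by omega
  have hu' : (1 : ℤ) * p ≤ 11 * ((n : ℤ) % p) := by rw [← Int.natCast_mod]; exact_mod_cast hu
  have hv' : (17 : ℤ) * ((n : ℤ) % p) < 2 * p := by rw [← Int.natCast_mod]; exact_mod_cast hv
  have hp0 : (p : ℚ) ≠ 0 := by exact_mod_cast hp.ne_zero
  have hD : ∀ m : ℕ, p ≤ m → padicNorm p ((Nat.lcmUpto m : ℕ) : ℚ) ≤ (p : ℚ) ^ (-(1 : ℤ)) := by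
    intro m hm
    have hdvd : ((p ^ 1 : ℕ) : ℤ) ∣ ((Nat.lcmUpto m : ℕ) : ℤ) := by
      rw [pow_one]; exact_mod_cast OddZeta.dvd_lcmUpto hp.one_lt.le hm
    have := (padicNorm.dvd_iff_norm_le (p := p)).1 hdvd
    simpa using this
  have h3 := padicNorm_formPT_le (p := p) hn hp2 (e := 2) fun k _ _ => phat_ivl_9_EZ hp hu' hv' k
  have hnorm : padicNorm p (z : ℚ) ≤ (p : ℚ) ^ (-(2 : ℤ)) := by
    rw [← hz, lcmNormaliser, Nat.cast_mul, padicNorm.mul, padicNorm.mul]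
    calc padicNorm p ((Nat.lcmUpto (16 * n) : ℕ) : ℚ) * padicNorm p ((Nat.lcmUpto (15 * n) : ℕ) : ℚ)
          * padicNorm p (formPT (aT n) (bT n))
        ≤ (p : ℚ) ^ (-(1 : ℤ)) * (p : ℚ) ^ (-(1 : ℤ)) * (p : ℚ) ^ (2 - (2 : ℤ)) :=
          mul_le_mul (mul_le_mul (hD _ (by omega)) (hD _ hp15) (padicNorm.nonneg _)
            (by positivity)) h3 (padicNorm.nonneg _) (by positivity)
      _ = (p : ℚ) ^ (-(2 : ℤ)) := by
          rw [← zpow_add₀ hp0, ← zpow_add₀ hp0]; norm_num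
  exact_mod_cast (padicNorm.dvd_iff_norm_le (p := p) (n := 2) (z := z)).2 hnorm

/-- **Both tales at a class prime of `ivl 9`:** `p ∣ D₁₆ₙD₁₅ₙ p_n + z` where
`z = D₁₆ₙD₁₅ₙ p̂_n ∈ ℤ` (first tale: `ivl_1_left`, as `[1/11,2/17) ⊂ [1/11,3/13)`; second tale:
`sq_dvd_of_integral`). -/
theorem dvd_sum_of_mem_classPrimes {n p : ℕ} (hn : 1 ≤ n)
    (h : p ∈ classPrimes 26 primeCut (ivl 9) n) {z : ℤ}
    (hz : ((lcmNormaliser n : ℕ) : ℚ) * formPT (aT n) (bT n) = z) : (p : ℤ) ∣ pP15num n + z := by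
  obtain ⟨hp, hp2, hu, hv⟩ := TwoTaleP15Levels.hyps_of_mem_classPrimes_ivl h
  have h1 : (1 / 11 : ℝ) ≤ Int.fract ((n : ℝ) / p) := by simpa [ivl] using hu
  have h2 : Int.fract ((n : ℝ) / p) < 2 / 17 := by simpa [ivl] using hv
  have hP := (ivl_1_left hn hp hp2 h1 (h2.trans (by norm_num))).2
  rw [pow_one] at hP
  exact dvd_add hP
    ((dvd_pow_self (p : ℤ) two_ne_zero).trans (sq_dvd_of_integral hn hp hp2 h1 h2 hz))

/-- **`P_n = ivlProduct 9 n` divides `D₁₆ₙD₁₅ₙ (p_n + p̂_n)`** (a product of distinct primes each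
dividing it). -/
theorem ivlProduct_dvd_sum {n : ℕ} (hn : 1 ≤ n) {z : ℤ}
    (hz : ((lcmNormaliser n : ℕ) : ℚ) * formPT (aT n) (bT n) = z) :
    (ivlProduct 9 n : ℤ) ∣ pP15num n + z := by
  rw [TwoTaleP15SavingAPI.ivlProduct_eq]
  have h : (∏ p ∈ classPrimes 26 primeCut (ivl 9) n, p) ∣ (pP15num n + z).natAbs :=
    Finset.prod_primes_dvd _
      (fun p hp => (TwoTaleP15Levels.hyps_of_mem_classPrimes_ivl hp).1.prime)
      (fun p hp => Int.natCast_dvd.1 (dvd_sum_of_mem_classPrimes hn hp hz))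
  exact Int.natCast_dvd.2 h

/-! ### The coincidence, eventually -/

/-- **`p_n = −p̂_n` for all large `n` (PROVED implication; the inputs `DecayT c'`, `IntegralT` are
NOT certified).**  `D₁₆ₙD₁₅ₙ(p_n + p̂_n)` is an integer multiple of `P_n` of absolute value
`≤ D₁₆ₙD₁₅ₙ (e^{−29.10787 n} + e^{−c' n}) < P_n`, hence `0`. -/
theorem pCoincidence_eventually {c' : ℝ} (hDT : DecayT c') (hc' : 31 - ivlRate 9 < c')
    (hT : IntegralT) :
    ∀ᶠ n : ℕ in atTop, formP (aP15 n) (bP15 n) = -formPT (aT n) (bT n) := by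
  have hW := TwoTaleWhipple.whippleP15_holds
  have hdec : ∀ᶠ n : ℕ in atTop, |(TwoTaleP15Forms.formQ n : ℝ) * zetaValue 2 -
      (TwoTaleP15Forms.formP n : ℝ)| ≤ Real.exp (-(29.10787 * n)) :=
    TwoTaleP15DecayHolds.decay_holds_sharp
  have hDT' : ∀ᶠ n : ℕ in atTop, |(formQT (aT n) (bT n) : ℝ) * zetaValue 2 -
      (formPT (aT n) (bT n) : ℝ)| ≤ Real.exp (-(c' * n)) := hDT
  have hT' : ∀ᶠ n : ℕ in atTop, ∃ z : ℤ, ((lcmNormaliser n : ℕ) : ℚ) * formPT (aT n) (bT n) = z :=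
    hT
  have h9 := ivlRate_nine_bounds
  set m : ℝ := min c' 29.10787 with hm_def
  have hm : 31 - ivlRate 9 < m := lt_min hc' (by linarith [h9.1])
  have hmc' : m ≤ c' := min_le_left _ _
  have hmc : m ≤ 29.10787 := min_le_right _ _
  obtain ⟨ε, hε, hgap⟩ : ∃ ε : ℝ, 0 < ε ∧ 3 * ε < m - (31 - ivlRate 9) :=
    ⟨(m - (31 - ivlRate 9)) / 4, by linarith, by linarith⟩
  have h2 : ∀ᶠ n : ℕ in atTop, (2 : ℝ) < Real.exp (ε * n) := by
    have ht : Tendsto (fun n : ℕ => Real.exp (ε * n)) atTop atTop :=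
      Real.tendsto_exp_atTop.comp (tendsto_natCast_atTop_atTop.const_mul_atTop hε)
    exact ht.eventually_gt_atTop 2
  filter_upwards [hDT', hdec, hT', eventually_exp_le_ivlProduct hε,
    eventually_lcmNormaliser_le_exp hε, h2, eventually_ge_atTop 1] with n hrT hr hz hP hD h2n hn
  obtain ⟨z, hz⟩ := hz
  have hn0 : (0 : ℝ) ≤ n := Nat.cast_nonneg n
  -- Whipple: `q_n = −q̂_n`
  have hq : (TwoTaleP15Forms.formQ n : ℝ) = -(formQT (aT n) (bT n) : ℝ) := by
    have e1 : formQ (aP15 n) (bP15 n) = (TwoTaleP15Forms.formQ n : ℚ) :=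
      TwoTaleP15Bridge.formQ_eq hn
    have e2 := bmissQ_of_whipple hW hn
    rw [e1] at e2
    have e3 := congrArg (fun x : ℚ => (x : ℝ)) e2
    push_cast at e3
    exact e3
  -- `|p_n + p̂_n| ≤ 2 e^{−m n}`
  have hx : |(TwoTaleP15Forms.formP n : ℝ) + (formPT (aT n) (bT n) : ℝ)| ≤
      2 * Real.exp (-(m * n)) := by
    have e : (TwoTaleP15Forms.formP n : ℝ) + (formPT (aT n) (bT n) : ℝ) =
        -(((TwoTaleP15Forms.formQ n : ℝ) * zetaValue 2 - TwoTaleP15Forms.formP n) +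
          ((formQT (aT n) (bT n) : ℝ) * zetaValue 2 - formPT (aT n) (bT n))) := by
      rw [hq]; ring
    rw [e, abs_neg]
    have i1 : Real.exp (-(29.10787 * n)) ≤ Real.exp (-(m * n)) :=
      Real.exp_le_exp.2 (neg_le_neg (mul_le_mul_of_nonneg_right hmc hn0))
    have i2 : Real.exp (-(c' * n)) ≤ Real.exp (-(m * n)) :=
      Real.exp_le_exp.2 (neg_le_neg (mul_le_mul_of_nonneg_right hmc' hn0))
    calc _ ≤ |(TwoTaleP15Forms.formQ n : ℝ) * zetaValue 2 - TwoTaleP15Forms.formP n| +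
          |(formQT (aT n) (bT n) : ℝ) * zetaValue 2 - formPT (aT n) (bT n)| := abs_add_le _ _
      _ ≤ 2 * Real.exp (-(m * n)) := by linarith
  -- the integer `D₁₆ₙD₁₅ₙ (p_n + p̂_n) = pP15num n + z`
  have hsumQ : ((pP15num n + z : ℤ) : ℚ) =
      ((lcmNormaliser n : ℕ) : ℚ) * (TwoTaleP15Forms.formP n + formPT (aT n) (bT n)) := by
    rw [Int.cast_add, ← pP15num_eq_formP hn, ← hz]; ring
  have hsum : ((pP15num n + z : ℤ) : ℝ) =
      (lcmNormaliser n : ℝ) * ((TwoTaleP15Forms.formP n : ℝ) + (formPT (aT n) (bT n) : ℝ)) := by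
    have e3 := congrArg (fun x : ℚ => (x : ℝ)) hsumQ
    push_cast at e3 ⊢
    linarith
  -- size `< P_n`
  have hD0 : (0 : ℝ) < (lcmNormaliser n : ℝ) := by exact_mod_cast lcmNormaliser_pos n
  have hlt : |((pP15num n + z : ℤ) : ℝ)| < (ivlProduct 9 n : ℝ) := by
    rw [hsum, abs_mul, abs_of_pos hD0]
    have hexp : Real.exp ((31 + ε) * n) * (2 * Real.exp (-(m * n))) <
        Real.exp ((ivlRate 9 - ε) * n) := by
      have e1 : Real.exp ((31 + ε) * n) * (2 * Real.exp (-(m * n))) =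
          2 * Real.exp ((31 + ε - m) * n) := by
        rw [show (31 + ε - m) * (n : ℝ) = (31 + ε) * n + -(m * n) by ring, Real.exp_add]; ring
      have e2 : Real.exp ((ivlRate 9 - ε) * n) =
          Real.exp ((ivlRate 9 - ε - (31 + ε - m)) * n) * Real.exp ((31 + ε - m) * n) := by
        rw [← Real.exp_add]; congr 1; ring
      rw [e1, e2]
      have hpos : 0 < Real.exp ((31 + ε - m) * n) := Real.exp_pos _
      have hge : Real.exp (ε * n) ≤ Real.exp ((ivlRate 9 - ε - (31 + ε - m)) * n) :=
        Real.exp_le_exp.2 (mul_le_mul_of_nonneg_right (by linarith) hn0)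
      have hg2 : 2 < Real.exp ((ivlRate 9 - ε - (31 + ε - m)) * n) := lt_of_lt_of_le h2n hge
      nlinarith [mul_pos (sub_pos.2 hg2) hpos]
    calc (lcmNormaliser n : ℝ) * |(TwoTaleP15Forms.formP n : ℝ) + (formPT (aT n) (bT n) : ℝ)|
        ≤ Real.exp ((31 + ε) * n) * (2 * Real.exp (-(m * n))) :=
          mul_le_mul hD hx (abs_nonneg _) (Real.exp_pos _).le
      _ < Real.exp ((ivlRate 9 - ε) * n) := hexp
      _ ≤ (ivlProduct 9 n : ℝ) := hP
  have hlt' : |pP15num n + z| < (ivlProduct 9 n : ℤ) := by exact_mod_cast hlt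
  have h0 : pP15num n + z = 0 := Int.eq_zero_of_abs_lt_dvd (ivlProduct_dvd_sum hn hz) hlt'
  -- conclude
  have hQ0 :
      ((lcmNormaliser n : ℕ) : ℚ) * (TwoTaleP15Forms.formP n + formPT (aT n) (bT n)) = 0 := by
    rw [← hsumQ, h0]; simp
  have hD0' : ((lcmNormaliser n : ℕ) : ℚ) ≠ 0 := by exact_mod_cast (lcmNormaliser_pos n).ne'
  have hsum0 := (mul_eq_zero.1 hQ0).resolve_left hD0'
  rw [formP_eq_formP hn]
  linarith

/-! ### The measure from an EVENTUAL inclusion / coincidence -/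

/-- `f` zeroed below `N`. -/
def cutoff {α : Type*} [Zero α] (N : ℕ) (f : ℕ → α) (n : ℕ) : α := if N ≤ n then f n else 0

/-- `cutoff N f n = f n` for `N ≤ n`. -/
theorem cutoff_of_le {α : Type*} [Zero α] {N n : ℕ} (f : ℕ → α) (h : N ≤ n) :
    cutoff N f n = f n := if_pos h

/-- `cutoff N f n = 0` for `n < N`. -/
theorem cutoff_of_lt {α : Type*} [Zero α] {N n : ℕ} (f : ℕ → α) (h : n < N) :
    cutoff N f n = 0 := if_neg (not_le.2 h)

/-- **The P15 measure from an EVENTUAL inclusion (PROVED):** the tree's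
`exponentLE_of_normalisedForms` applied to the forms zeroed below the threshold — the decay and
the coefficient rate are asymptotic, and the normalised inclusions then hold for every `n`. -/
theorem exponentLE_of_eventual_inclusion {c C₁ : ℝ}
    (hI : ∀ᶠ n : ℕ in atTop,
      (∃ B : ℤ, ((lcmNormaliser n : ℕ) : ℤ) * TwoTaleP15Forms.formQ n = (savingProduct n : ℤ) * B) ∧
        ∃ A : ℤ, ((lcmNormaliser n : ℕ) : ℚ) * TwoTaleP15Forms.formP n = (savingProduct n : ℚ) * A)
    (hD : Decay c) (hC : CoeffRate C₁) (hc : 31 - savingRate < c) (hC₀ : 0 < C₁) :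
    ExponentLE (zetaValue 2) (1 + (C₁ + (31 - savingRate)) / (c - (31 - savingRate))) := by
  obtain ⟨N, hN⟩ := eventually_atTop.1 hI
  have hB' : ∀ n : ℕ, ∃ B : ℤ, ((lcmNormaliser n : ℕ) : ℤ) * cutoff N TwoTaleP15Forms.formQ n =
      (savingProduct n : ℤ) * B := by
    intro n
    rcases le_or_gt N n with h | h
    · obtain ⟨B, hB⟩ := (hN n h).1
      exact ⟨B, by rw [cutoff_of_le _ h, hB]⟩
    · exact ⟨0, by rw [cutoff_of_lt _ h, mul_zero, mul_zero]⟩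
  have hA' : ∀ n : ℕ, ∃ A : ℤ, ((lcmNormaliser n : ℕ) : ℚ) * cutoff N TwoTaleP15Forms.formP n =
      (savingProduct n : ℚ) * A := by
    intro n
    rcases le_or_gt N n with h | h
    · obtain ⟨A, hA⟩ := (hN n h).2
      exact ⟨A, by rw [cutoff_of_le _ h, hA]⟩
    · exact ⟨0, by rw [cutoff_of_lt _ h, mul_zero, Int.cast_zero, mul_zero]⟩
  choose B hB using hB'
  choose A hA using hA'
  have hD' : ∀ᶠ n : ℕ in atTop, |(TwoTaleP15Forms.formQ n : ℝ) * zetaValue 2 -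
      (TwoTaleP15Forms.formP n : ℝ)| ≤ Real.exp (-(c * n)) := hD
  have hC' : Tendsto (fun n : ℕ => Real.log |(TwoTaleP15Forms.formQ n : ℝ)| / n) atTop (𝓝 C₁) :=
    hC
  have hdec : ∀ᶠ n : ℕ in atTop, |((cutoff N TwoTaleP15Forms.formQ n : ℤ) : ℝ) * zetaValue 2 -
      ((cutoff N TwoTaleP15Forms.formP n : ℚ) : ℝ)| ≤ Real.exp (-(c * n)) := by
    filter_upwards [hD', eventually_ge_atTop N] with n h hn
    rw [cutoff_of_le _ hn, cutoff_of_le _ hn]; exact h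
  have hrate : Tendsto (fun n : ℕ => Real.log |((cutoff N TwoTaleP15Forms.formQ n : ℤ) : ℝ)| / n)
      atTop (𝓝 C₁) := by
    refine hC'.congr' ?_
    filter_upwards [eventually_ge_atTop N] with n hn
    rw [cutoff_of_le _ hn]
  exact exponentLE_of_normalisedForms irrational_zetaValue_two lcmNormaliser_pos savingProduct_pos
    (fun n _ => hB n) (fun n _ => hA n) hdec hrate tendsto_log_lcmNormaliser_div_savingProduct hc
    hC₀ (by linarith [savingRate_lt])

/-- **P15 endgame from an EVENTUAL `p`-coincidence (PROVED implication; the hypothesis is NOT a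
tree theorem):** `(∀ᶠ n, p_n = −p̂_n) → μ(ζ(2)) ≤ 5.0499 ∧ (μ(ζ(2)) ≤ 5.09541179)` — the tree's
`zetaTwo_exponent_le_of_pCoincidence` with "for all `n ≥ 1`" weakened to "for all large `n`"
(`q_n = −q̂_n`: `TwoTaleWhipple.whippleP15_holds`; decay: `decay_holds_sharp`; coefficient rate:
`coeffRate_of_whipple`; certified `S ≥ 15.98084`, `C₁* ≤ 42.0374`). -/
theorem zetaTwo_exponent_le_of_eventual_pCoincidence
    (hP : ∀ᶠ n : ℕ in atTop, formP (aP15 n) (bP15 n) = -formPT (aT n) (bT n)) :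
    ExponentLE (zetaValue 2) 5.0499 ∧ zetaTwo_irrationalityExponent_le := by
  have hW := TwoTaleWhipple.whippleP15_holds
  have hI : ∀ᶠ n : ℕ in atTop,
      (∃ B : ℤ, ((lcmNormaliser n : ℕ) : ℤ) * TwoTaleP15Forms.formQ n = (savingProduct n : ℤ) * B) ∧
        ∃ A : ℤ, ((lcmNormaliser n : ℕ) : ℚ) * TwoTaleP15Forms.formP n =
          (savingProduct n : ℚ) * A := by
    filter_upwards [hP, eventually_ge_atTop 1] with n hp hn
    have hb := And.intro (bmissQ_of_whipple hW hn) hp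
    refine ⟨?_, ⟨pP15num n / (savingProduct n : ℤ), ?_⟩⟩
    · obtain ⟨B, hB⟩ := savingProduct_dvd_qP15 hn hb
      refine ⟨((lcmNormaliser n : ℕ) : ℤ) * B, ?_⟩
      rw [← qP15_eq_formQ hn, hB]; ring
    · rw [pP15num_eq_formP hn, Int.cast_div (savingProduct_dvd_pP15num hn hb)
        (by exact_mod_cast (savingProduct_pos n).ne'), Int.cast_natCast,
        mul_div_cancel₀ _ (by exact_mod_cast (savingProduct_pos n).ne')]
  have hS := savingRate_bounds
  have hC := TwoTaleP15Growth.C₁star_le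
  have h := exponentLE_of_eventual_inclusion hI TwoTaleP15DecayHolds.decay_holds_sharp
    (TwoTaleP15Growth.coeffRate_of_whipple hW) (by linarith [hS.1]) TwoTaleP15Growth.C₁star_pos
  have hden : (0 : ℝ) < 29.10787 - (31 - savingRate) := by linarith [hS.1]
  have hle : 1 + (TwoTaleP15Growth.C₁star + (31 - savingRate)) / (29.10787 - (31 - savingRate)) ≤
      5.0499 := by
    have h1 : (TwoTaleP15Growth.C₁star + (31 - savingRate)) / (29.10787 - (31 - savingRate)) ≤
        4.0499 := by
      rw [div_le_iff₀ hden]; nlinarith [hS.1]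
    linarith
  have h' : ExponentLE (zetaValue 2) 5.0499 := h.mono hle
  exact ⟨h', (zetaTwo_record_of_exponentLE h' (by norm_num)).1⟩

/-! ### Assembly -/

/-- **P15 with (bmiss) replaced by the two second-tale inputs (PROVED implication; `DecayT c'`
and `IntegralT` are NOT certified, `IntegralT` is not in print):**
`DecayT c' → 31 − ivlRate 9 < c' → IntegralT → μ(ζ(2)) ≤ 5.0499 ∧ (μ(ζ(2)) ≤ 5.09541179)`. -/
theorem zetaTwo_exponent_le_of_decayT {c' : ℝ} (hDT : DecayT c') (hc' : 31 - ivlRate 9 < c')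
    (hT : IntegralT) : ExponentLE (zetaValue 2) 5.0499 ∧ zetaTwo_irrationalityExponent_le :=
  zetaTwo_exponent_le_of_eventual_pCoincidence (pCoincidence_eventually hDT hc' hT)

/-- **Numeric threshold:** any second-tale decay constant `c' ≥ 28.462` suffices
(`31 − ivlRate 9 ≤ 31 − 2.5381141 < 28.462`; the model rate is `29.10787`). -/
theorem zetaTwo_exponent_le_of_decayT_num (hDT : DecayT 28.462) (hT : IntegralT) :
    ExponentLE (zetaValue 2) 5.0499 ∧ zetaTwo_irrationalityExponent_le :=
  zetaTwo_exponent_le_of_decayT hDT (by linarith [ivlRate_nine_bounds.1]) hT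

end Summit.KontsevichZagierPeriods.Zeta5Search.Denom.TwoTaleP15Coincidence

end
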